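import Summits.CriticalPhenomena.PercolationContinuityZ3.Theorems.PercNearOneGluingNoHeavyLowerTailSunflowerSpectatorTransfer
import Summits.CriticalPhenomena.PercolationContinuityZ3.Theorems.PercNearOneGluingNoHeavyLowerTailSunflowerOrPetal
import Summits.CriticalPhenomena.PercolationContinuityZ3.Theorems.PercNearOneGluingNoHeavyLowerTailSunflowerRestrictionSeriesPair
import HarnessLib
import HarnessLib.Audit

/-!
# `NoHeavyLowerTail` (crux stmt-CriticalPhenomena-4575), abstract sunflower cubic: the SPECTATOR-TRANSFER inequality (♣)
# `2·Nabk ≤ SA + SB + 2·Nkk` holds behind a DISJUNCTIVE petal generated by TWO points — the first FAT (non-intersecting) petal class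

Support file (seat `prim-ineq-gen-2` gen 22; `--supports stmt-CriticalPhenomena-4575`).  No `sorry`, no named facts; nothing is asserted about the crux.
Memo: run/shared/lean/prim/prim-ineq-gen-2/SPECTATOR-TRANSFER-GEN22.md §8 (exact LP certificate, kit j151806) and gen22/BLUEPRINT-club3-orpetal2-lean.md.

`SpectatorTransfer` (♣, `…SunflowerSpectatorTransfer`, typed conjecture) is proved in the tree behind a centred petal and behind an intersecting
petal (`…SunflowerSpectatorTransferIntersecting`).  Here: behind the petal `3` of a sunflower with `IsOrPetal {s,t}` (`…SunflowerOrPetal`: the petal-`3`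
sets are exactly the non-kernel sets meeting `{s,t}`; such a petal contains the disjoint sets `{s}`, `{t}` whenever they are not kernel, so it is in general
neither intersecting nor centred).

PROOF (two-point trace expansion + 14 antipodal-Gladkov rows + a finite kernel check).  Write `E' = univ ∖ {s,t}`.  Expanding the ordered
3-partitions of `α` by the blocks receiving `s` and `t` (`nested_insert_split` of …RestrictionSeriesPair, twice) turns `Q := SA + SB + 2·Nkk 3 − 2·Nabk 3` into a nested sum over the
ordered 3-partitions `(X,S,T)` of `E'` of a kernel `nineKer` of the BLOCK DATA `(lab X, lab (X+s), lab (X+t), lab (X+s+t))` of the three blocks, minus nothing; we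
subtract and add the spectator rows `Σ_X [X ∈ 𝒯₂] · Σ_{S ⊆ E'∖X} kk (lab S) (lab (E'∖X∖S))` (`𝒯₂` = "`lab X ≠ 0`, or `lab X = 0`, `lab (X+s) = lab (X+t) = 3`,
`lab (X+s+t) = 4`"), each `≥ 0` by `Sunflower.antipodal_gladkov`.  Under `IsOrPetal {s,t}` the block data of a subset of `E'` takes only 8 values
(`exists_blockCode`), and the fully symmetrised difference kernel is nonnegative on all `8³` code triples (`nineKer_symm_nonneg`, `decide`; the unsymmetrised
kernel is not, and neither trace class is separately nonnegative — gen22/clubtrace.py).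
-/

namespace Summit.CriticalPhenomena.PercolationContinuityZ3.Theorems.SunflowerPartition

open Finset

/-! ## Finite kernels -/

/-- Kernel of `Q = SA + SB + 2·Nkk 3 − 2·Nabk 3` on an ordered 3-partition with labels `(x,y,z)`. [this work] -/
def clubKer (x y z : Fin 5) : ℤ :=
  (if x = 0 ∨ x = 4 then kk y z else 0) + (if x = 3 ∧ y = 3 then 2 else 0) - (if x = 4 ∧ y = 0 ∧ z = 3 then 2 else 0)

/-- Pointwise form of `Q`'s summand. [this work] -/
theorem clubKer_eq : ∀ x y z : Fin 5,
    (if x = 4 then (1 : ℤ) else 0) * kk y z + (if x = 0 then (1 : ℤ) else 0) * kk y z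
      + 2 * (if x = 3 ∧ y = 3 then (1 : ℤ) else 0) - 2 * (if x = 4 ∧ y = 0 ∧ z = 3 then (1 : ℤ) else 0) = clubKer x y z := by
  decide

/-- Block data: the labels of `X`, `X+s`, `X+t`, `X+s+t`. [this work] -/
abbrev BlockData := Fin 5 × Fin 5 × Fin 5 × Fin 5

/-- Weight of the spectator row of a first block with data `a`: `1` on `𝒯₂`, else `0`. [this work] -/
def rowW (a : BlockData) : ℤ :=
  if a.1 ≠ 0 ∨ (a.2.1 = 3 ∧ a.2.2.1 = 3 ∧ a.2.2.2 = 4) then 1 else 0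

/-- `rowW ≥ 0`. [this work] -/
theorem rowW_nonneg (a : BlockData) : 0 ≤ rowW a := by
  unfold rowW; split_ifs <;> norm_num

/-- The nine placements of `s,t` into the blocks, minus the spectator row of the first block. [this work] -/
def nineKer (a b c : BlockData) : ℤ :=
  clubKer a.2.2.2 b.1 c.1 + clubKer a.2.1 b.2.2.1 c.1 + clubKer a.2.1 b.1 c.2.2.1
    + clubKer a.2.2.1 b.2.1 c.1 + clubKer a.1 b.2.2.2 c.1 + clubKer a.1 b.2.1 c.2.2.1
    + clubKer a.2.2.1 b.1 c.2.1 + clubKer a.1 b.2.2.1 c.2.1 + clubKer a.1 b.1 c.2.2.2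
    - rowW a * kk b.1 c.1

/-- Full symmetrisation of a ternary kernel on any type. [this work] -/
def symm6Of {β : Type*} (g : β → β → β → ℤ) (x y z : β) : ℤ :=
  g x y z + g x z y + g y x z + g y z x + g z x y + g z y x

/-- The 8 block-data values that occur for subsets of `E'` behind a two-point disjunctive petal. [this work] -/
def blockCode : Fin 8 → BlockData :=
  ![(1, 4, 4, 4), (2, 4, 4, 4), (4, 4, 4, 4), (0, 3, 3, 3), (0, 3, 3, 4), (0, 3, 4, 4), (0, 4, 3, 4), (0, 4, 4, 4)]

/-- **Finite kernel check**: the symmetrised difference kernel is nonnegative on all `8³` code triples. [this work] -/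
theorem nineKer_symm_nonneg : ∀ a b c : Fin 8, 0 ≤ symm6Of nineKer (blockCode a) (blockCode b) (blockCode c) := by
  decide

/-- Admissibility of a block-data quadruple behind a two-point disjunctive petal (free label `≠ 3`, lifted labels in `{3,4}`, diamond
monotonicity along `X ⊆ X+s ⊆ X+s+t` and `X ⊆ X+t ⊆ X+s+t`), as a Boolean test. [this work] -/
def blockAdmissible (x xs xt xst : Fin 5) : Bool :=
  x ≠ 3 && (xs = 3 || xs = 4) && (xt = 3 || xt = 4) && (xst = 3 || xst = 4) &&
    (x = xs || x = 0 || xs = 4) && (x = xt || x = 0 || xt = 4) && (xs = xst || xs = 0 || xst = 4) && (xt = xst || xt = 0 || xst = 4)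

/-- Every admissible block-data quadruple is one of the 8 codes. [this work] -/
theorem exists_blockCode_of : ∀ x xs xt xst : Fin 5, blockAdmissible x xs xt xst = true → ∃ c : Fin 8, blockCode c = (x, xs, xt, xst) := by
  decide

/-! ## Nested partition sums: symmetrisation with an arbitrary block statistic, positivity (one-point splitting is `nested_insert_split`, …RestrictionSeriesPair) -/

variable {α : Type*} [DecidableEq α]

/-- Six times a nested kernel sum is the nested sum of the symmetrised kernel (any block statistic `L`). [this work] -/
theorem six_mul_nested_eq_symm6Of {β : Type*} (W : Finset α) (L : Finset α → β) (g : β → β → β → ℤ) :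
    6 * nested W (fun X S T => g (L X) (L S) (L T)) = nested W (fun X S T => symm6Of g (L X) (L S) (L T)) := by
  have e1 : nested W (fun X S T => g (L X) (L S) (L T)) = nested W (fun X S T => g (L X) (L T) (L S)) :=
    nested_swap23 W (fun X S T => g (L X) (L S) (L T))
  have e2 : nested W (fun X S T => g (L X) (L S) (L T)) = nested W (fun X S T => g (L S) (L X) (L T)) :=
    nested_swap12 W (fun X S T => g (L X) (L S) (L T))
  have e3 : nested W (fun X S T => g (L X) (L S) (L T)) = nested W (fun X S T => g (L S) (L T) (L X)) :=
    e1.trans (nested_swap12 W (fun X S T => g (L X) (L T) (L S)))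
  have e4 : nested W (fun X S T => g (L X) (L S) (L T)) = nested W (fun X S T => g (L T) (L X) (L S)) :=
    e2.trans (nested_swap23 W (fun X S T => g (L S) (L X) (L T)))
  have e5 : nested W (fun X S T => g (L X) (L S) (L T)) = nested W (fun X S T => g (L T) (L S) (L X)) :=
    e3.trans (nested_swap23 W (fun X S T => g (L S) (L T) (L X)))
  have key : nested W (fun X S T => symm6Of g (L X) (L S) (L T))
      = nested W (fun X S T => g (L X) (L S) (L T)) + nested W (fun X S T => g (L X) (L T) (L S))
        + nested W (fun X S T => g (L S) (L X) (L T)) + nested W (fun X S T => g (L S) (L T) (L X))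
        + nested W (fun X S T => g (L T) (L X) (L S)) + nested W (fun X S T => g (L T) (L S) (L X)) := by
    unfold nested symm6Of
    simp only [sum_add_distrib]
  rw [key, ← e1, ← e2, ← e3, ← e4, ← e5]
  ring

/-- A nested sum of a pointwise nonnegative kernel is nonnegative. [this work] -/
theorem nested_nonneg_of_forall (W : Finset α) (G : Finset α → Finset α → Finset α → ℤ)
    (hG : ∀ X, X ⊆ W → ∀ S, S ⊆ W \ X → 0 ≤ G X S ((W \ X) \ S)) : 0 ≤ nested W G := by
  unfold nested
  exact sum_nonneg fun X hX => sum_nonneg fun S hS => hG X (mem_powerset.1 hX) S (mem_powerset.1 hS)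

/-- The sum over `parts α` as a nested sum on `univ`. [this work] -/
theorem sum_parts_eq_nested_univ [Fintype α] (g : Finset α → Finset α → Finset α → ℤ) :
    ∑ q ∈ parts α, g q.1 q.2 (q.1 ∪ q.2)ᶜ = nested univ g := by
  rw [nested_eq_sum_filter, ← partsOf_univ]
  unfold partsOf
  refine sum_congr rfl fun q _ => ?_
  rw [compl_eq_univ_sdiff]

namespace Sunflower

variable (F : Sunflower α)

/-- Spectator rows with an ARBITRARY nonnegative weight of the first block are nonnegative (antipodal Gladkov on every complement cube). [this work] -/
theorem nested_weight_mul_kk_nonneg (W : Finset α) (w : Finset α → ℤ) (hw : ∀ X, 0 ≤ w X) :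
    0 ≤ nested W (fun X S T => w X * kk (F.lab S) (F.lab T)) := by
  unfold nested
  refine sum_nonneg fun X _ => ?_
  rw [← mul_sum]
  exact mul_nonneg (hw X) (F.antipodal_gladkov (W \ X))

/-- `Q = SA + SB + 2·Nkk 3 − 2·Nabk 3` as a `parts`-sum of `clubKer`. [this work] -/
theorem club_eq_sum_parts [Fintype α] :
    F.SA + F.SB + 2 * F.Nkk 3 - 2 * F.Nabk 3 = ∑ q ∈ parts α, clubKer (F.lab q.1) (F.lab q.2) (F.lab (q.1 ∪ q.2)ᶜ) := by
  unfold SA SB Sw Nkk Nabk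
  rw [mul_sum, mul_sum, ← sum_add_distrib, ← sum_add_distrib, ← sum_sub_distrib]
  exact sum_congr rfl fun q _ => clubKer_eq _ _ _

/-! ## The theorem -/

/-- The block data of `X` relative to `s, t`. [this work] -/
def blockData (s t : α) (X : Finset α) : BlockData :=
  (F.lab X, F.lab (insert s X), F.lab (insert t X), F.lab (insert s (insert t X)))

/-- Behind a two-point disjunctive petal, the block data of a set avoiding `s,t` is one of the 8 codes. [this work] -/
theorem exists_blockCode {s t : α} (h : F.IsOrPetal {s, t}) {X : Finset α} (hs : s ∉ X) (ht : t ∉ X) :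
    ∃ c : Fin 8, blockCode c = F.blockData s t X := by
  unfold blockData
  have h34 : ∀ Y : Finset α, (Y ∩ {s, t}).Nonempty → F.lab Y = 3 ∨ F.lab Y = 4 := h.2.1
  have ns : F.lab (insert s X) = 3 ∨ F.lab (insert s X) = 4 :=
    h34 _ ⟨s, mem_inter.2 ⟨mem_insert_self _ _, mem_insert_self _ _⟩⟩
  have nt : F.lab (insert t X) = 3 ∨ F.lab (insert t X) = 4 :=
    h34 _ ⟨t, mem_inter.2 ⟨mem_insert_self _ _, mem_insert_of_mem (mem_singleton_self _)⟩⟩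
  have nst : F.lab (insert s (insert t X)) = 3 ∨ F.lab (insert s (insert t X)) = 4 :=
    h34 _ ⟨s, mem_inter.2 ⟨mem_insert_self _ _, mem_insert_self _ _⟩⟩
  have x3 : F.lab X ≠ 3 := by
    intro h3
    obtain ⟨x, hx⟩ := h.2.2 X h3
    rw [mem_inter, mem_insert, mem_singleton] at hx
    rcases hx.2 with rfl | rfl
    · exact hs hx.1
    · exact ht hx.1
  have m1 := F.lab_mono (subset_insert s X)
  have m2 := F.lab_mono (subset_insert t X)
  have m3 := F.lab_mono (insert_subset_insert s (subset_insert t X))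
  have m4 := F.lab_mono (subset_insert s (insert t X))
  refine exists_blockCode_of _ _ _ _ ?_
  simp only [blockAdmissible, Bool.and_eq_true, Bool.or_eq_true, decide_eq_true_eq, or_assoc]
  exact ⟨⟨⟨⟨⟨⟨⟨x3, ns⟩, nt⟩, nst⟩, m1⟩, m2⟩, m3⟩, m4⟩

/-- **(♣) behind a two-point disjunctive petal**: if the petal `3` is exactly the family of non-kernel sets meeting `{s,t}` (`s ≠ t`), then
`2·Nabk 3 ≤ SA + SB + 2·Nkk 3`. [this work] -/
theorem spectatorTransfer_three_of_isOrPetal_pair [Fintype α] {s t : α} (hst : s ≠ t) (h : F.IsOrPetal {s, t}) :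
    2 * F.Nabk 3 ≤ F.SA + F.SB + 2 * F.Nkk 3 := by
  set E' : Finset α := univ \ {s, t} with hE'
  have hsE : s ∉ E' := fun hh => (mem_sdiff.1 hh).2 (mem_insert_self _ _)
  have htE : t ∉ E' := fun hh => (mem_sdiff.1 hh).2 (mem_insert_of_mem (mem_singleton_self _))
  have hsW : s ∉ insert t E' := fun hh => by
    rcases mem_insert.1 hh with hh | hh
    · exact hst hh
    · exact hsE hh
  have huniv : (univ : Finset α) = insert s (insert t E') := by
    ext x
    simp only [mem_univ, mem_insert, hE', mem_sdiff, mem_singleton, true_and, true_iff]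
    tauto
  -- the kernel as a function of the blocks, and the block statistic
  set G : Finset α → Finset α → Finset α → ℤ := fun X S T => clubKer (F.lab X) (F.lab S) (F.lab T) with hG
  set L : Finset α → BlockData := F.blockData s t with hL
  -- Q as a nested sum on `insert s (insert t E')`, split along `s` and `t`, regrouped: nine placements minus the rows, plus the rows
  have hsplit : nested (insert s (insert t E')) G
      = nested E' (fun X S T => nineKer (L X) (L S) (L T)) + nested E' (fun X S T => rowW (L X) * kk (F.lab S) (F.lab T)) := by
    rw [nested_insert_split _ s hsW, nested_insert_split _ t htE, nested_insert_split _ t htE, nested_insert_split _ t htE]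
    unfold nested
    simp only [hG, hL, blockData, nineKer, sum_add_distrib, sum_sub_distrib]
    ring
  -- positivity of the symmetrised kernel, block by block through the 8 codes
  have hker : 0 ≤ nested E' (fun X S T => nineKer (L X) (L S) (L T)) := by
    have h6 := six_mul_nested_eq_symm6Of E' L nineKer
    have hpos : 0 ≤ nested E' (fun X S T => symm6Of nineKer (L X) (L S) (L T)) := by
      refine nested_nonneg_of_forall E' _ fun X hX S hS => ?_
      have hT : (E' \ X) \ S ⊆ E' := sdiff_subset.trans sdiff_subset
      have hS' : S ⊆ E' := hS.trans sdiff_subset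
      obtain ⟨a, ha⟩ := F.exists_blockCode h (fun hh => hsE (hX hh)) (fun hh => htE (hX hh))
      obtain ⟨b, hb⟩ := F.exists_blockCode h (fun hh => hsE (hS' hh)) (fun hh => htE (hS' hh))
      obtain ⟨c, hc⟩ := F.exists_blockCode h (fun hh => hsE (hT hh)) (fun hh => htE (hT hh))
      rw [hL, ← ha, ← hb, ← hc]
      exact nineKer_symm_nonneg a b c
    linarith
  have hrows : 0 ≤ nested E' (fun X S T => rowW (L X) * kk (F.lab S) (F.lab T)) :=
    F.nested_weight_mul_kk_nonneg E' (fun X => rowW (L X)) fun X => rowW_nonneg _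
  have hQ' : F.SA + F.SB + 2 * F.Nkk 3 - 2 * F.Nabk 3
      = nested E' (fun X S T => nineKer (L X) (L S) (L T)) + nested E' (fun X S T => rowW (L X) * kk (F.lab S) (F.lab T)) := by
    rw [F.club_eq_sum_parts, sum_parts_eq_nested_univ (fun X S T => clubKer (F.lab X) (F.lab S) (F.lab T)), huniv]
    exact hsplit
  linarith

end Sunflower

end Summit.CriticalPhenomena.PercolationContinuityZ3.Theorems.SunflowerPartition
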